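import Summits.ValiantsHypothesis.ValiantsHypothesis.Theses.DivisionGap
import Summits.ValiantsHypothesis.ValiantsHypothesis.Theorems.PerDivisionHard.Negative.LoadBearing
import Summits.ValiantsHypothesis.ValiantsHypothesis.Theorems.PerDivisionHard.Negative.VarsCounting
import Summits.ValiantsHypothesis.ValiantsHypothesis.Theorems.PerDivisionHard.Negative.BooleanShadow
import Summits.ValiantsHypothesis.ValiantsHypothesis.Theorems.PerDivisionHard.Negative.PlainBridge
import Summits.ValiantsHypothesis.ValiantsHypothesis.Theorems.ZeroOneTransfer.Negative.TopComponentFree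

/-!
# Disproof of `PerDivisionHard` — findings of the standing disprover (crux `stmt-ValiantsHypothesis-5065`)

Crux (route `DivisionGap`, H1):
`PerDivisionHard := ∀ c, ∃ n₀, ∀ n ≥ n₀, ∀ h : ℝ≥0[x_ij] (n × n), h ≠ 0 →
  2 ^ ((Nat.log 2 n + c) ^ c) < L(per_n · h) + L(h)`,
`L = Literature.Computability.AlgebraicComplexity.complexity` over the semiring `ℝ≥0` (= monotone
weighted-sum / product fan-in-two circuit size): "the permanent has super-quasi-polynomial
subtraction-free complexity WITH division", in the Hrubeš–Yehudayoff normal form `f · h = g`.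
In print this is the `per`-instance (with `h` charged, at quasi-polynomial strength) of an OPEN
PROBLEM: HY21 §6 Problem 2 = Open Problem 3; Jukna, *Tropical Circuit Complexity* (2023) §6.4
Problem 4 ("Prove a super-polynomial lower bound on the size of monotone arithmetic (+,×,/) circuits
computing an explicit monotone polynomial"; solved only for FORMULAS, via shadows, HY21).

## VERDICT (cycles 1–2): NO KILL, NOT MISSTATED; picked line attacked, no stub refuted — and why no cheap kill can exist

1. **A kill is a breakthrough.** `¬ PerDivisionHard` gives `c` and infinitely many `n` with a
   monotone pair `g = per_n · h`, `h ≠ 0`, `L₊(g) + L₊(h) ≤ 2^{(log₂ n + c)^c}`.  Read over `ℝ`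
   (`ArithCircuit.map`), `per_n = g/h` is a circuit with ONE division; `h(𝟙) > 0` (nonzero, nonnegative
   coefficients), so Strassen's division elimination at output degree `n` (invert `h` as a power
   series at the all-ones point, truncate at degree `n`, cost `O(n²)·size`) yields
   `L_ℝ(per_n) ≤ 2^{O((log n + c)^c)}` for infinitely many `n`: the permanent would be in
   quasi-polynomial (non-uniform) circuit size over `ℝ` infinitely often — the failure of the (a.e.)
   EXTENDED VALIANT HYPOTHESIS `VNP ⊄ VQP`, with the known Boolean fallout under GRH (Bürgisser 2000,
   "Cook's versus Valiant's hypothesis").  Conversely the crux FOLLOWS from "`L_ℝ(per_n)`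
   super-quasi-polynomial for all large `n`".  So the crux is sandwiched directly under a standard
   conjecture; no small model, degenerate regime or computation can bite (the `∀ c ∃ n₀` shape is
   immune to finite data anyway).  Recorded as the sorried near-miss
   `not_perDivisionHard_imp_per_quasipoly_io` (no division elimination for `ArithCircuit` in the tree).
2. **Faithful, not misstated.** Read back symbol by symbol: bound `2 ^ ((Nat.log 2 n + c) ^ c) : ℕ`,
   strict `<` in `ℕ`; `complexity` = fan-in-two circuits with free `ℝ≥0` constants and `ℝ≥0`-weighted
   sum gates — monotone, no division, differs from Jerrum–Snir's plain model by constant factors only;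
   `h` lives in the same `n²` variables (no loss over `ℝ≥0`: extra variables specialise to `1`).
   Mutations that DO NOT change refutability: the i.o. form (weaker, suffices for the Assembly —
   route-review note), `PerMultiplesHard` (stronger, `h` not charged).
3. **The quasi-polynomial threshold is where all known methods stop.**  Known lower-bound reach for
   pairs `(per_n · h, h)`:  `h` a nonzero constant — Jerrum–Snir `n(2^{n-1}-1)` (tree, `prodCount`
   model; bridged to `complexity` with a factor `2` by `Negative/PlainBridge.lean`, p73877);  `h` a monomial —
   Jukna–Seiwert–Sergeev 2022 Thm 1 / HY21 Prop 43(3) (gain at most quadratic);  `coeff 0 h ≠ 0` —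
   the Boolean shadow of `per_n · h` is PERFECT MATCHING (`shadow_perPoly_mul_iff`, this seat), so
   Razborov 1985 gives `n^{Ω(log n)}`: super-polynomial but NOT super-quasi-polynomial — it proves
   NO instance `c ≥ 2` of the crux;  monotone FORMULAS with division — `≥ σ(DS_n) ≥ 2^{Ω(log² n)}`
   (HY21 Thm 42 + Prop 23): again exactly quasi-polynomial.  Both partial methods die precisely at the
   crux's threshold, which is forced by H2's quasi-polynomial slack.  (Planner note: at
   SUPER-POLYNOMIAL strength the sub-case `coeff 0 h ≠ 0` of H1 is a theorem modulo vendoring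
   Razborov 1985 + the Boolean transfer lemma; the general `h` is Jukna's Problem 4 verbatim.)
4. **Where a refutation (or a new idea) must live:** multipliers WITHOUT constant term.  For
   `h = ∏ x_ij` the Boolean shadow is void (`shadow_perPoly_mul_prod_X_iff`); for `h = per_n^{m-1}`
   (powers) transparency dies (HY21 Rem 45) and only the Boolean `n^{Ω(log n)}` survives (Rem 46
   pattern); for `h = ∏_i (Σ_j x_ij)^a` (Hrubeš-type row-sum powers) the support of `per·h` is the
   set of row-degree-`(a+1)` patterns containing a perfect matching — Boolean shadow = PM again, so
   `n^{Ω(log n)}` and no more.  NONE of these is excluded as a counterexample to instances `c ≥ 2` by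
   anything in print; equally, none is known to be monotone-easier than `per_n` itself.
5. **Tropical shadow.** A pair `(g, h)` tropicalises to a `(min,+,−)` circuit of size
   `L₊(g) + L₊(h) + 1` for the ASSIGNMENT problem (FGK14 §2; HKL25 App. A).  So `(min,+,−)` lower
   bounds for assignment would PROVE the crux — but Jukna 2023 §6.4 Problem 3 asks whether assignment
   HAS polynomial `(min,+,−)` circuits and leans yes (Hungarian algorithm); Problem 5 (any explicit
   `(min,+,−)` lower bound) is open.  The converse transfer fails, so a positive answer to Problem 3
   would not refute the crux either.  Dead end in both directions, recorded.

## CHECKED CONTENT (sorry-free; landed under `Theorems/PerDivisionHard/Negative/`)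

(a) LOAD-BEARING hypotheses (`Negative/LoadBearing.lean`, p72677):
  * `perDivisionHard_false_without_nonzero` — drop `h ≠ 0`: false (`h = 0`).
  * `perDivisionHard_false_without_threshold`, `pair_at_one_eq_zero` — drop `∃ n₀`: false at
    `n = 0, 1` (`per_0 = 1`, `per_1 = x₀₀` are free).
  * `perDivisionHard_false_uniform` — `∃ n₀ ∀ c`: false (`2^{(log n₀ + c)^c} → ∞`).
  * `perDivisionHard_false_of_charTwo`, `perDivisionHard_false_over_zmod2` — the semiring is
    load-bearing: over any nontrivial commutative ring of characteristic two `per = det` and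
    `L(det_n) ≤ 8(n+1)^7` (Berkowitz), pair `h = 1`, witness `c = 4`.  Any proof must use
    no-cancellation in `ℝ≥0`; over fields of characteristic `≠ 2` the analogue is the open one-division
    form of `per ∉ VQP`.
(b) TIGHTNESS window (`LoadBearing.lean`): `exists_pair_le_factorial` (`h = 1`: `≤ (n+1)·n!`;
    Jerrum–Snir's Laplace circuit gives `n·2^n`), `perDivisionHard_false_at_factorial_rate`.
(c) FLOOR — where counterexamples cannot live (`Negative/VarsCounting.lean`, p72879):
    `card_vars_le_complexity` (`#vars f ≤ 2·L(f) + 1`, new reusable circuit lemma),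
    `vars_perPoly_mul` (every `x_ij` occurs in `per_n · h`), `sq_le_of_pair` (`n² ≤ 2 L(per_n h) + 1`),
    `perDivisionHard_rung_zero` (`c = 0` holds from `n = 3`), `perDivisionHard_rung_one` (`c = 1`
    holds from `n = 5`).  The crux is open exactly from `c = 2` (`> 16 · n^{log₂ n + 4}` for all `h`).
(d) BOOLEAN SHADOW (`Negative/BooleanShadow.lean`, p73723):
    `shadow_mul_iff_of_coeff_zero_ne_zero`, `shadow_perPoly_mul_iff` (= perfect matching),
    `shadow_mul_prod_X_iff`, `shadow_perPoly_mul_prod_X_iff` (void).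
(d') BRIDGE to Jerrum–Snir (`Negative/PlainBridge.lean`, p73877, accepted):
    `exists_plain_of_computes` (weighted fan-in-two → plain with `prodCount ≤ 2·size`),
    `js_le_two_mul_complexity_perPoly` (`n(2^{n-1}-1) ≤ 2·L(per_n)`), `pair_const_lower_bound`
    (the constant-`h` rung in closed form: `n(2^{n-1}-1) ≤ 2(L(per_n·C a) + L(C a)) + 2`, `a ≠ 0`) —
    answers the "missing bridge" flagged by grounder g18-33 and the route reviewer (restated below as
    `js_floor`, `pair_const_floor`).
(e) NEAR-MISS (sorried here only): `not_perDivisionHard_imp_per_quasipoly_io`.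
(f) Targets: line `pair-descent-jss-endpoint` picked; `stuck_stubs = []`; the lead's open stub is K2 (see LINE section).

## LINE `pair-descent-jss-endpoint` (PICKED 2026-08-16T03:44; cycle-2 attack, details in item evidence
`line-pair-descent-c2.md`)
Stubs: `stub_torus` ✓ provable · `stub_faceDescent` ✓ provable, `h ≠ 0` LOAD-BEARING
(`stub_faceDescent_false_without_nonzero` below; `HasSingleGPart` is vacuous at `h = 0`) · `stub_jssContraction` ✓
literature-true, RAW constants consistent (`κ = 4`) · `stub_blockArsenal` ✓ provable (`b ≥ (log n+d)^d` obviously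
load-bearing) · `stub_noCheapOmnipresence` (K2) OPEN, not refuted.  Joint sufficiency: kernel-checked glue, no gap.
Rigidity criteria handed to the lead: (P) products are rigid iff their factors are; (S) with the exact weight
`w = W·𝟙_G + B^{idx}` off `G` one has `CutsOut` and "two top monomials tie ⇔ they differ by a circulation inside
`G ∩ D_h`" (`D_h` = difference support), so ANY `h` admitting an admissible placement with `G ∩ D_h` acyclic satisfies
K2; by a first-moment count such a placement exists unless `|D_h| ≥ (1 - O(b² log b/n))·n²`.  Hence a counterexample to
K2 must be cheap, non-product at the top, with difference support of density `→ 1` and `G`-circulations of length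
`≥ girth` on EVERY large-girth block placement — the permanent minus cheapness (cheapness is K2's load-bearing
hypothesis: `h = per_n` refutes K2-without-the-bound).  All families named by ideators/triage/lead (`h_L`, 2×2-minor
products, banded/DP permutation sums, sparse face permanents, group permanents incl. `Aut(T)`) are rigid by (P)/(S).
Torus-homogeneity is convenience, not strength: potentials `φ(col) + ψ(row)` inside `w` perform the torus slicing
implicitly, so K2 without it reduces to the same criterion.
DATA (`k2_autT_test.py`, local, results `k2_autT_results.jsonl` in item evidence): for the one cheap EXPONENTIAL family,
the group permanent of `Aut(T_n)` (`2^{n-1}` monomials, cost `O(n²)`), all 168 random placements tried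
(`n = 16…256`, `b = 2…5`, `k = 1…3`) gave a UNIQUE top monomial under the exact weight of (S) (tree DP, exact count of
maximisers) — K2 holds empirically there; the adaptive maximal `G`-mass grows like `≈ 1.6 √n` (so for tree-like groups
the prover should take `k ≳ √n`).  Iterated wreath products `S_s ≀ ⋯ ≀ S_s` (`s ≤ 6`, `n ≤ 256`; admissible at
`s = polylog`, far more adaptive): again 0 ties in 32 placements, `M ≈ c_s √n`, `c_s ≤ 2.4` (`k2_wreath_test.py`).
For permutation-supported `h` a tie needs a non-identity `π ∈ supp⁻¹supp` with `|supp π| ≤ M` realised by `G`-cycles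
of length `≥ 4(2k+1)`, so `M < 4k+2` excludes ties outright: K2 on margins `(1,…,1)` is exactly the discrepancy
statement "some large-girth placement has `max_{σ ∈ supp h} |μ_σ ∩ G| < girth/2`" — `per_n` has `M = n`, every cheap
family named so far has `M = O(√n)`.

## DATA (kit job `j008396`, shadow_birkhoff.py, 960 s, exit 0; artefact `shadow_birkhoff.json`, sha256 8608…92b1)
Certified LOWER bounds on the shadow complexity `σ(DS_n)` (HY21 Problem 1) from random Gaussian planar
projections + hill climbing (240 s per `n`), the best projection rounded to integers and its strict hull
vertices re-counted in exact integer arithmetic (certificate = integer `2 × n²` matrix + vertex list in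
the JSON):
`n : 2 3 4 5 6 7`,  `σ(DS_n) ≥ : 2 6 16 23 28 35`,  `n! : 2 6 24 120 720 5040`.
Heuristic search only (no optimality claim; `n = 4`: 16 of 24 after 2·10⁴ restarts).  The slow growth is
consistent with the printed state `2^{Ω(log² n)} ≤ σ(DS_n) ≤ 2^{O(n)}` (HY21 Prop 23) and gives the
formula-with-division rung of this crux (HY21 Thm 42: leaves ≥ σ(DS_n)) nothing beyond quasi-polynomial
at these sizes; it is data for support item ShadowBirkhoff (5069), not evidence about the crux.

## LITERATURE (2026-08-16)
HY21 (CCC 2021; journal version Israel J. Math. 2023) §6; Jukna 2023 book §6.1–6.4 (Thm 6.1/Rem 6.3: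
`ST` has `O(n³)` `(+,×,/)` circuits with ONE division; §6.3 reciprocal inputs almost useless; §6.4
Problems 3–5 as quoted above); JuknaSeiwertSergeev2022; FGK14/16; `lit citing` HY21 → "Negations are
powerful even in small depth" (2026, constant depth, not division); `lit citing` FGK14 → NEW
Hertrich–Kober–Loho 2025 (arXiv:2511.02406) Thm 1: regular-matroid basis polynomials have uniform
`O(n³)` `(+,×,/)` circuits — removes "regular matroids" from the suspected counterexamples to H2
`ZeroOneTransfer` (does not touch H1).  Nothing in print proves or refutes any instance `c ≥ 2`.
-/

noncomputable section

set_option linter.dupNamespace false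

namespace Summit.ValiantsHypothesis.ValiantsHypothesis.Cruxes.PerDivisionHard.Disproof

open Literature.Computability.AlgebraicComplexity MvPolynomial
open Summit.ValiantsHypothesis.ValiantsHypothesis.Theses.DivisionGap (PerDivisionHard)
open Summit.ValiantsHypothesis.Theorems.PerDivisionHardNegative
open scoped NNReal

/-! ### The crux and its variants as named propositions (workfile only) -/

/-- `PerDivisionHard` with the coefficient semiring `ℝ≥0` replaced by an arbitrary commutative
semiring `k`; the crux is the instance `k = ℝ≥0` (`perDivisionHard_iff_over_nnreal`). -/
def PerDivisionHardOver (k : Type) [CommSemiring k] : Prop :=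
  ∀ c : ℕ, ∃ n₀ : ℕ, ∀ n ≥ n₀, ∀ h : MvPolynomial (Fin n × Fin n) k, h ≠ 0 →
    2 ^ ((Nat.log 2 n + c) ^ c) < complexity (perPoly (Fin n) k * h) + complexity h

/-- The crux is literally the `ℝ≥0` instance. -/
theorem perDivisionHard_iff_over_nnreal : PerDivisionHard ↔ PerDivisionHardOver ℝ≥0 := Iff.rfl

/-- The crux with `h ≠ 0` dropped. -/
def PerDivisionHardWithoutNonzero : Prop :=
  ∀ c : ℕ, ∃ n₀ : ℕ, ∀ n ≥ n₀, ∀ h : MvPolynomial (Fin n × Fin n) ℝ≥0,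
    2 ^ ((Nat.log 2 n + c) ^ c) < complexity (perPoly (Fin n) ℝ≥0 * h) + complexity h

/-- The crux with the threshold dropped (claimed for every `n`). -/
def PerDivisionHardWithoutThreshold : Prop :=
  ∀ c : ℕ, ∀ n : ℕ, ∀ h : MvPolynomial (Fin n × Fin n) ℝ≥0, h ≠ 0 →
    2 ^ ((Nat.log 2 n + c) ^ c) < complexity (perPoly (Fin n) ℝ≥0 * h) + complexity h

/-- The crux with the quantifiers swapped (`n₀` uniform in `c`). -/
def PerDivisionHardUniform : Prop :=
  ∃ n₀ : ℕ, ∀ c : ℕ, ∀ n ≥ n₀, ∀ h : MvPolynomial (Fin n × Fin n) ℝ≥0, h ≠ 0 →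
    2 ^ ((Nat.log 2 n + c) ^ c) < complexity (perPoly (Fin n) ℝ≥0 * h) + complexity h

/-- The crux with the threshold raised to the factorial rate `(n+1)·n!`. -/
def PerDivisionHardFactorialRate : Prop :=
  ∃ n₀ : ℕ, ∀ n ≥ n₀, ∀ h : MvPolynomial (Fin n × Fin n) ℝ≥0, h ≠ 0 →
    (n + 1) * n.factorial < complexity (perPoly (Fin n) ℝ≥0 * h) + complexity h

/-- The matrix of the crux at a fixed exponent `c` (the crux is `∀ c, PerDivisionHardAt c`). -/
def PerDivisionHardAt (c : ℕ) : Prop :=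
  ∃ n₀ : ℕ, ∀ n ≥ n₀, ∀ h : MvPolynomial (Fin n × Fin n) ℝ≥0, h ≠ 0 →
    2 ^ ((Nat.log 2 n + c) ^ c) < complexity (perPoly (Fin n) ℝ≥0 * h) + complexity h

/-- Unfolding. -/
theorem perDivisionHard_iff_forall_at : PerDivisionHard ↔ ∀ c, PerDivisionHardAt c := Iff.rfl

/-! ### (a) Load-bearing hypotheses (from `Negative/LoadBearing.lean`) -/

/-- Any proof must use `h ≠ 0`. -/
theorem perDivisionHard_false_without_nonzero' : ¬ PerDivisionHardWithoutNonzero :=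
  perDivisionHard_false_without_nonzero

/-- Any proof must use the threshold `n₀` (false at `n = 0`, `n = 1`). -/
theorem perDivisionHard_false_without_threshold' : ¬ PerDivisionHardWithoutThreshold :=
  perDivisionHard_false_without_threshold

/-- The dependence `c ↦ n₀(c)` is essential. -/
theorem perDivisionHard_false_uniform' : ¬ PerDivisionHardUniform :=
  perDivisionHard_false_uniform

/-- Monotonicity (no cancellation) is load-bearing: the characteristic-two analogue is false. -/
theorem not_perDivisionHardOver_of_charTwo (k : Type) [CommRing k] [CharP k 2] [Nontrivial k] :
    ¬ PerDivisionHardOver k :=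
  perDivisionHard_false_of_charTwo k

/-- Instance `𝔽₂`. -/
theorem not_perDivisionHardOver_zmod2 : ¬ PerDivisionHardOver (ZMod 2) :=
  perDivisionHard_false_over_zmod2

/-! ### (b) Tightness window -/

/-- The threshold cannot be raised to `(n+1)·n!` (pair `h = 1`). -/
theorem not_perDivisionHardFactorialRate : ¬ PerDivisionHardFactorialRate :=
  perDivisionHard_false_at_factorial_rate

/-! ### (c) The floor: instances `c = 0, 1` hold, so counterexamples need `c ≥ 2` -/

/-- `c = 0` holds (from `n = 3`). -/
theorem perDivisionHardAt_zero : PerDivisionHardAt 0 := perDivisionHard_rung_zero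

/-- `c = 1` holds (from `n = 5`). -/
theorem perDivisionHardAt_one : PerDivisionHardAt 1 := perDivisionHard_rung_one

/-- Hence any counterexample exponent is at least `2`: `¬ PerDivisionHardAt c → 2 ≤ c`. -/
theorem two_le_of_not_perDivisionHardAt {c : ℕ} (hc : ¬ PerDivisionHardAt c) : 2 ≤ c := by
  by_contra h
  interval_cases c
  · exact hc perDivisionHardAt_zero
  · exact hc perDivisionHardAt_one

/-- The universal floor for the crux's pairs: `n² ≤ 2·L(per_n · h) + 1` for every `h ≠ 0`. -/
theorem floor (n : ℕ) {h : MvPolynomial (Fin n × Fin n) ℝ≥0} (hh : h ≠ 0) :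
    n * n ≤ 2 * complexity (perPoly (Fin n) ℝ≥0 * h) + 1 :=
  sq_le_of_pair hh

/-! ### (c') The Jerrum–Snir floor through the bridge (from `Negative/PlainBridge.lean`) -/

/-- `n (2^{n-1} - 1) ≤ 2 · L(per_n)` for the crux's weighted `complexity` (Jerrum–Snir §4.3 + bridge). -/
theorem js_floor {n : ℕ} (hn : 1 ≤ n) : n * (2 ^ (n - 1) - 1) ≤ 2 * complexity (perPoly (Fin n) ℝ≥0) :=
  js_le_two_mul_complexity_perPoly hn

/-- The constant-multiplier rung in closed form: no counterexample to the crux has `h` a nonzero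
constant (the pair then costs at least `n(2^{n-1}-1)/2 - 1`, exponential). -/
theorem pair_const_floor {n : ℕ} (hn : 1 ≤ n) {a : ℝ≥0} (ha : a ≠ 0) :
    n * (2 ^ (n - 1) - 1) ≤
      2 * (complexity (perPoly (Fin n) ℝ≥0 * C a) + complexity (C a : MvPolynomial (Fin n × Fin n) ℝ≥0)) + 2 :=
  pair_const_lower_bound hn ha

/-! ### (d) The Boolean shadow of the crux's pairs (from `Negative/BooleanShadow.lean`) -/

/-- For `h` with a constant term the Boolean shadow of `per_n · h` is PERFECT MATCHING: the Boolean
transfer hands these pairs Razborov's `n^{Ω(log n)}` and nothing super-quasi-polynomial. -/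
theorem shadow_is_perfectMatching {n : ℕ} {h : MvPolynomial (Fin n × Fin n) ℝ≥0} (h0 : coeff 0 h ≠ 0)
    (S : Finset (Fin n × Fin n)) :
    (∃ m ∈ (perPoly (Fin n) ℝ≥0 * h).support, m.support ⊆ S) ↔ ∃ ρ : Equiv.Perm (Fin n), ∀ j, (ρ j, j) ∈ S :=
  shadow_perPoly_mul_iff h0 S

/-- For `h = ∏ x_ij` the Boolean shadow of `per_n · h` is void: the transfer proves nothing there. -/
theorem shadow_void_at_prod_X {n : ℕ} (S : Finset (Fin n × Fin n)) :
    (∃ m ∈ (perPoly (Fin n) ℝ≥0 * ∏ v, X v).support, m.support ⊆ S) ↔ S = Finset.univ :=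
  shadow_perPoly_mul_prod_X_iff S

/-! ### Line `pair-descent-jss-endpoint`: load-bearing hypothesis of `stub_faceDescent`
(duplicated from `Negative/LineFaceDescentLoadBearing.lean`, proposal in flight; notions inline) -/

section Line

open Summit.ValiantsHypothesis.ValiantsHypothesis.Theorems.ZeroOneTransfer.Negative
  (topComponent topComponent_zero)

/-- The line's `HasSingleGPart G w h u` clause is vacuous at `h = 0`. -/
theorem line_hasSingleGPart_zero {n : ℕ} (G : Finset (Fin n × Fin n)) (w : Fin n × Fin n → ℕ)
    (u : (Fin n × Fin n) →₀ ℕ) (hu : u.support ⊆ G) :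
    u.support ⊆ G ∧ ∀ m ∈ (topComponent w (0 : MvPolynomial (Fin n × Fin n) ℝ≥0)).support,
      ∀ e ∈ G, m e = u e := by
  refine ⟨hu, ?_⟩
  intro m hm
  simp [topComponent_zero] at hm

/-- `stub_faceDescent` with `h ≠ 0` deleted is FALSE (`n = 2, G = univ, w = 0, h = 0, u = 0`). -/
theorem line_stub_faceDescent_false_without_nonzero :
    ¬ ∀ (n : ℕ) (G : Finset (Fin n × Fin n)) (w : Fin n × Fin n → ℕ)
        (h : MvPolynomial (Fin n × Fin n) ℝ≥0) (u : (Fin n × Fin n) →₀ ℕ),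
        (∀ σ : Equiv.Perm (Fin n),
          (∀ i, (σ i, i) ∈ G) ↔ ∀ τ : Equiv.Perm (Fin n), (∑ i, w (τ i, i)) ≤ ∑ i, w (σ i, i)) →
        (u.support ⊆ G ∧ ∀ m ∈ (topComponent w h).support, ∀ e ∈ G, m e = u e) →
        complexity (monomial u (1 : ℝ≥0) *
            ∑ σ ∈ (Finset.univ : Finset (Equiv.Perm (Fin n))).filter (fun σ => ∀ i, (σ i, i) ∈ G),
              monomial (permMonomial σ) (1 : ℝ≥0)) ≤
          complexity (perPoly (Fin n) ℝ≥0 * h) + 1 := by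
  intro H
  have hcut : ∀ σ : Equiv.Perm (Fin 2),
      (∀ i, (σ i, i) ∈ (Finset.univ : Finset (Fin 2 × Fin 2))) ↔
        ∀ τ : Equiv.Perm (Fin 2), (∑ i, (fun _ : Fin 2 × Fin 2 => (0 : ℕ)) (τ i, i)) ≤
          ∑ i, (fun _ : Fin 2 × Fin 2 => (0 : ℕ)) (σ i, i) := by
    intro σ; simp
  have hsingle := line_hasSingleGPart_zero (Finset.univ : Finset (Fin 2 × Fin 2)) (fun _ => 0) 0
    (by simp)
  have h := H 2 Finset.univ (fun _ => 0) 0 0 hcut hsingle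
  have hface : (∑ σ ∈ (Finset.univ : Finset (Equiv.Perm (Fin 2))).filter
      (fun σ => ∀ i, (σ i, i) ∈ (Finset.univ : Finset (Fin 2 × Fin 2))),
        monomial (permMonomial σ) (1 : ℝ≥0)) = perPoly (Fin 2) ℝ≥0 := by
    rw [Finset.filter_true_of_mem (fun σ _ i => Finset.mem_univ _), perPoly_eq_sum_monomial]
  have hmon : (monomial (0 : (Fin 2 × Fin 2) →₀ ℕ) (1 : ℝ≥0)) = 1 := rfl
  rw [hface, hmon, one_mul, mul_zero, complexity_zero, zero_add] at h
  have hfloor := sq_le_of_pair (n := 2) (h := (1 : MvPolynomial (Fin 2 × Fin 2) ℝ≥0)) one_ne_zero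
  rw [mul_one] at hfloor
  omega

end Line

/-! ### (e) Near-miss: the reduction that explains why the crux resists

`¬ PerDivisionHard → per_n` has quasi-polynomial circuits over `ℝ` for infinitely many `n`.
Paper proof (Strassen 1973, one division): monotone circuits for `g = per_n · h` and `h` of size `s`
are circuits over `ℝ` of the same size (`ArithCircuit.map NNReal.toRealHom`); `a := h(1,…,1) > 0`;
after `x ↦ x + 𝟙`, `h = a(1 - u)` with `u(0) = 0`, so `per_n(x + 𝟙) ≡ (g(x+𝟙)/a) · Σ_{j ≤ n} u^j`
modulo degree `> n`; extracting homogeneous components up to degree `n` of a size-`s'` circuit costs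
`O(n² s')` (Strassen/Valiant homogenisation); shift back.  Total `2^{O((log n + c)^c)}`.  NOT
formalised: the tree has no division elimination / homogeneous-component extraction for
`ArithCircuit` (only `DepthReduction.SLP.homogenize` in `GateQuotients.lean`, another circuit type);
several hundred lines.  Consequence for would-be disprovers: a kill of this crux is a quasi-polynomial
upper bound for infinitely many permanents — do not expect one from small models. -/

/-- NEAR-MISS (sorried; see the section docstring): any refutation of the crux puts infinitely many
permanents in quasi-polynomial circuit size over `ℝ` (constant-factor loss in the exponent absorbed
generously as `c + 1`). -/
theorem not_perDivisionHard_imp_per_quasipoly_io :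
    ¬ PerDivisionHard → ∃ c : ℕ, ∀ n₀ : ℕ, ∃ n ≥ n₀,
      complexity (perPoly (Fin n) ℝ) ≤ 2 ^ ((Nat.log 2 n + (c + 1)) ^ (c + 1)) := by
  sorry

end Summit.ValiantsHypothesis.ValiantsHypothesis.Cruxes.PerDivisionHard.Disproof

end
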